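import Literature.NumberTheory.LocalFields.NodeValuesUnitBinomialTwist
import Literature.NumberTheory.LocalFields.StrassmannTheorem
import Mathlib.NumberTheory.Padics.Complex
import Mathlib.Tactic
import HarnessLib

/-!
# Binomial twists of integral power series WITHOUT unit content: over a densely valued complete
# `ℚ_p`-algebra (e.g. `ℂ_p`) the exponent of `F' = c·(1+X)^e·F` still lies in `ℤ_p`
# (Gouvêa, *p-adic Numbers*, §5.9 Problem 194; Robert, *A Course in p-adic Analysis*, V.2.4, VI.2.1)

Topic `NumberTheory/LocalFields`; namespace `Literature.NumberTheory.LocalFields`. Everything here is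
proved (theorems only; no definitions, no named facts, no `sorry`). Sequel of
`BinomialTwistExponentPadicIntegral.lean` / `NodeValuesUnitBinomialTwist.lean`, which assume that the two
integral series `F, F'` have UNIT CONTENT (a coefficient of norm `1`). Over `ℂ_p` the supremum of the
coefficient norms of an integral series need not be attained, so unit content cannot be arranged by a
constant rescaling; the remedy is to rescale the VARIABLE: for `0 < ‖a‖ < 1` the series `F(aX)` has
coefficients `aⁿ[Xⁿ]F → 0`, whose maximum IS attained (Strassman's index, `exists_strassmann_index`),
and the key identity of Gouvêa's integrality argument transports along `X ↦ aX`
(`PowerSeries.rescale a`) with the weight `1 + X` replaced by `1 + aX` and the binomial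
coefficients `C(e,k)` replaced by `C(e,k)·aᵏ`. Letting `‖a‖ → 1` removes the defect.

* §1 (private plumbing) `derivative_rescale`, `iterate_derivative_rescale` (`(F(aX))^{(k)} = aᵏ·F^{(k)}(aX)`).
* §2 `rescale_mul_divided_derivative_eq_sum_of_binomial_twist` — the key identity of
  `BinomialTwistExponentPadicIntegral` transported along `X ↦ aX`:
  `F(aX)·(1+aX)^k·(F'(aX))^{(k)}/k! = F'(aX)·Σ_{i+j=k} (e(e−1)⋯(e−i+1)aⁱ/i!)·(1+aX)^j·(F(aX))^{(j)}/j!`.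
* §3 `norm_descPochhammer_mul_le_of_rescaled_identity` — the integrality induction for that identity:
  if `Φ, Φ'` are integral, `Φ·Φ'` has a coefficient of norm `1`, `‖a‖ ≤ 1`, then
  `‖e(e−1)⋯(e−k+1)·aᵏ‖ ≤ ‖k!‖` for all `k`.
* §4 **`norm_descPochhammer_mul_norm_pow_le_of_binomial_twist`** — if `F' = Q·F` with `(1+X)Q′ = eQ`,
  `F, F' ≠ 0` integral (NO unit content), then `‖e(e−1)⋯(e−k+1)‖·‖a‖ᵏ ≤ ‖k!‖` for every `0 < ‖a‖ < 1`;
  **`exists_padicInt_eq_of_binomial_twist_of_ne_zero`** — over a normed `ℚ_p`-algebra whose value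
  group accumulates at `1` from below (`ℂ_p`: `PadicComplex.exists_norm_lt_one_lt`), `e ∈ ℤ_p`.
* §5 **`exists_padicInt_binomial_twist_of_node_values_of_ne_zero`** — the node theorem of
  `NodeValuesUnitBinomialTwist` without the unit-content hypotheses: `f, g` integral, `u` a one-unit
  not a root of unity, `g(uᵗ − 1) = c·dᵗ·f(uᵗ − 1)` (`t ∈ ℕ`), one `f(u^{t₀} − 1) ≠ 0` ⟹ `g = Q·f`,
  `(1+X)Q′ = zQ`, `z ∈ ℤ_p`, `‖[Xⁿ]Q‖ ≤ ‖Q(0)‖`; and its `ℂ_p` form.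

Use (cell `bsd-print-cf2`, route C, the «(R) period-rigidity» lane of item 23722): the monomial lines
of two Katz–de Shalit frames `G, G'` of one branch at two period triples are integral series over
`𝒪_{ℂ_p}` with node-proportional values but no a-priori unit content; this file makes the
one-variable rigidity `G'|_ℓ = C·(1+X)^{z_ℓ}·G|_ℓ`, `z_ℓ ∈ ℤ_p`, available on every line.

## References

* F. Q. Gouvêa, *p-adic Numbers: An Introduction*, Universitext, Springer 1993, §5.9 Lemma 5.9.1 and
  Problem 194 (held text pp. 131–132); §5.6 Thm. 5.6.1 (Strassman). [Gouvea1993PadicNumbers]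
* A. M. Robert, *A Course in p-adic Analysis*, GTM 198, Springer 2000, Ch. V §2.4 Theorem 1;
  Ch. VI §2.1. [Robert2000PadicAnalysis]
-/

noncomputable section

open Finset Filter Topology PowerSeries

namespace Literature.NumberTheory.LocalFields

/-! ## §1. Derivatives of the rescaled series `F(aX)` -/

section Rescale

variable {K : Type*} [Field K]

/-- `rescale a (C c) = C c`. [folklore] -/
private theorem rescale_C' (a c : K) : rescale a (C c) = C c := by
  ext n
  rw [coeff_rescale, coeff_C]
  split_ifs with h
  · rw [h, pow_zero, one_mul]
  · rw [mul_zero]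

/-- `D(C c · f) = C c · D f`. [folklore] -/
private theorem derivative_C_mul' (c : K) (f : K⟦X⟧) : derivative K (C c * f) = C c * derivative K f := by
  rw [← smul_eq_C_mul, ← smul_eq_C_mul, (derivative K).map_smul]

/-- **`(F(aX))′ = a·F′(aX)`.** [folklore] -/
private theorem derivative_rescale (a : K) (f : K⟦X⟧) :
    derivative K (rescale a f) = C a * rescale a (derivative K f) := by
  ext n
  rw [coeff_derivative, coeff_rescale, coeff_C_mul, coeff_rescale, coeff_derivative]
  ring

/-- **`(F(aX))^{(k)} = aᵏ·F^{(k)}(aX)`.** [folklore] -/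
private theorem iterate_derivative_rescale (a : K) (f : K⟦X⟧) (k : ℕ) :
    (derivative K)^[k] (rescale a f) = C (a ^ k) * rescale a ((derivative K)^[k] f) := by
  induction k with
  | zero => simp
  | succ k ih =>
    rw [Function.iterate_succ_apply', ih, derivative_C_mul', derivative_rescale, ← mul_assoc, ← map_mul,
      Function.iterate_succ_apply', pow_succ]

/-- `(C c · f)^{(k)} = C c · f^{(k)}`. [folklore] -/
private theorem iterate_derivative_C_mul (c : K) (f : K⟦X⟧) (k : ℕ) :
    (derivative K)^[k] (C c * f) = C c * (derivative K)^[k] f := by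
  induction k with
  | zero => simp
  | succ k ih => rw [Function.iterate_succ_apply', ih, derivative_C_mul', Function.iterate_succ_apply']

end Rescale

/-! ## §2. The key identity transported along `X ↦ aX` -/

section KeyIdentity

variable {K : Type*} [NormedField K] [CharZero K]

/-- **The key identity, rescaled.** If `(1+X)Q′ = eQ` and `F' = Q·F`, then for `a ≠ 0` and every `k`,
with `Φ = F(aX)`, `Φ' = F'(aX)`:
`Φ·(1+aX)^k·Φ'^{(k)}/k! = Φ'·Σ_{i+j=k} (e(e−1)⋯(e−i+1)·aⁱ/i!)·(1+aX)^j·Φ^{(j)}/j!`.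
[cite: Gouvea1993PadicNumbers, §5.9 (the binomial series `B(α, X)`, p. 131)] -/
theorem rescale_mul_divided_derivative_eq_sum_of_binomial_twist {F F' Q : K⟦X⟧} {e : K}
    (hQ : (1 + X) * derivative K Q = C e * Q) (hF' : F' = Q * F) {a : K} (ha : a ≠ 0) (k : ℕ) :
    rescale a F * ((1 + C a * X) ^ k * (C ((k.factorial : K)⁻¹) * (derivative K)^[k] (rescale a F'))) =
      rescale a F' * ∑ ij ∈ antidiagonal k,
        C ((∏ l ∈ range ij.1, (e - (l : K))) * a ^ ij.1 / (ij.1.factorial : K)) *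
          ((1 + C a * X) ^ ij.2 * (C ((ij.2.factorial : K)⁻¹) * (derivative K)^[ij.2] (rescale a F))) := by
  -- `rescale a (D^j G) = C (a^j)⁻¹ · D^j (rescale a G)`
  have hD : ∀ (G : K⟦X⟧) (j : ℕ), rescale a ((derivative K)^[j] G) =
      C ((a ^ j)⁻¹) * (derivative K)^[j] (rescale a G) := fun G j ↦ by
    rw [iterate_derivative_rescale, ← mul_assoc, ← map_mul, inv_mul_cancel₀ (pow_ne_zero j ha), map_one,
      one_mul]
  have hinv : C (a ^ k) * C ((a ^ k)⁻¹) = (1 : K⟦X⟧) := by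
    rw [← map_mul, mul_inv_cancel₀ (pow_ne_zero k ha), map_one]
  -- left-hand sides
  have hL : rescale a F * ((1 + C a * X) ^ k * (C ((k.factorial : K)⁻¹) * (derivative K)^[k] (rescale a F'))) =
      C (a ^ k) * rescale a (F * ((1 + X) ^ k * (C ((k.factorial : K)⁻¹) * (derivative K)^[k] F'))) := by
    rw [map_mul (rescale a), map_mul (rescale a), map_mul (rescale a), map_pow (rescale a),
      map_add (rescale a), map_one (rescale a), rescale_X, rescale_C', hD F' k]
    set D := (derivative K)^[k] (rescale a F')
    linear_combination (-(rescale a F * (1 + C a * X) ^ k * C ((k.factorial : K)⁻¹) * D)) * hinv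
  -- right-hand sides, term by term
  have hR : rescale a F' * ∑ ij ∈ antidiagonal k,
        C ((∏ l ∈ range ij.1, (e - (l : K))) * a ^ ij.1 / (ij.1.factorial : K)) *
          ((1 + C a * X) ^ ij.2 * (C ((ij.2.factorial : K)⁻¹) * (derivative K)^[ij.2] (rescale a F))) =
      C (a ^ k) * rescale a (F' * ∑ ij ∈ antidiagonal k,
        C ((∏ l ∈ range ij.1, (e - (l : K))) / (ij.1.factorial : K)) *
          ((1 + X) ^ ij.2 * (C ((ij.2.factorial : K)⁻¹) * (derivative K)^[ij.2] F))) := by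
    conv_rhs => rw [map_mul (rescale a), map_sum (rescale a), mul_left_comm, mul_sum]
    refine congrArg (rescale a F' * ·) (sum_congr rfl fun ij hij ↦ ?_)
    have hk : ij.1 + ij.2 = k := mem_antidiagonal.1 hij
    have hC : C (a ^ k) * C ((∏ l ∈ range ij.1, (e - (l : K))) / (ij.1.factorial : K)) *
        C ((a ^ ij.2)⁻¹) = C ((∏ l ∈ range ij.1, (e - (l : K))) * a ^ ij.1 / (ij.1.factorial : K)) := by
      rw [← map_mul, ← map_mul]
      congr 1
      rw [← hk, pow_add]
      field_simp
    rw [map_mul (rescale a), map_mul (rescale a), map_mul (rescale a), map_pow (rescale a),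
      map_add (rescale a), map_one (rescale a), rescale_X, rescale_C', rescale_C', hD F ij.2]
    set D := (derivative K)^[ij.2] (rescale a F)
    linear_combination (-((1 + C a * X) ^ ij.2 * C ((ij.2.factorial : K)⁻¹) * D)) * hC
  rw [hL, hR, mul_divided_derivative_eq_sum_of_binomial_twist hQ hF' k]

end KeyIdentity

/-! ## §3. Integrality induction for the rescaled identity -/

section Integral

variable {K : Type*} [NormedField K] [IsUltrametricDist K]

/-- Sums of integral series are integral. [folklore] -/
private theorem bde_int_add {F G : K⟦X⟧} (hF : ∀ n, ‖coeff n F‖ ≤ 1) (hG : ∀ n, ‖coeff n G‖ ≤ 1)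
    (n : ℕ) : ‖coeff n (F + G)‖ ≤ 1 := by
  rw [map_add]; exact (IsUltrametricDist.norm_add_le_max _ _).trans (max_le (hF n) (hG n))

/-- Differences of integral series are integral. [folklore] -/
private theorem bde_int_sub {F G : K⟦X⟧} (hF : ∀ n, ‖coeff n F‖ ≤ 1) (hG : ∀ n, ‖coeff n G‖ ≤ 1)
    (n : ℕ) : ‖coeff n (F - G)‖ ≤ 1 := by
  rw [sub_eq_add_neg]
  exact bde_int_add hF (fun m ↦ by rw [map_neg, norm_neg]; exact hG m) n

/-- Products of integral series are integral. [folklore] -/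
private theorem bde_int_mul {F G : K⟦X⟧} (hF : ∀ n, ‖coeff n F‖ ≤ 1) (hG : ∀ n, ‖coeff n G‖ ≤ 1)
    (n : ℕ) : ‖coeff n (F * G)‖ ≤ 1 := by
  rw [coeff_mul]
  refine IsUltrametricDist.norm_sum_le_of_forall_le_of_nonneg zero_le_one fun ij _ ↦ ?_
  rw [norm_mul]
  exact mul_le_one₀ (hF _) (norm_nonneg _) (hG _)

/-- Finite sums of integral series are integral. [folklore] -/
private theorem bde_int_sum {ι : Type*} {s : Finset ι} {F : ι → K⟦X⟧}
    (hF : ∀ i ∈ s, ∀ n, ‖coeff n (F i)‖ ≤ 1) (n : ℕ) : ‖coeff n (∑ i ∈ s, F i)‖ ≤ 1 := by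
  rw [map_sum]
  exact IsUltrametricDist.norm_sum_le_of_forall_le_of_nonneg zero_le_one fun i hi ↦ hF i hi n

omit [IsUltrametricDist K] in
/-- A constant of norm `≤ 1` times an integral series is integral. [folklore] -/
private theorem bde_int_C_mul {c : K} (hc : ‖c‖ ≤ 1) {F : K⟦X⟧} (hF : ∀ n, ‖coeff n F‖ ≤ 1)
    (n : ℕ) : ‖coeff n (C c * F)‖ ≤ 1 := by
  rw [coeff_C_mul, norm_mul]; exact mul_le_one₀ hc (norm_nonneg _) (hF n)

/-- `(1 + aX)^m` is integral for `‖a‖ ≤ 1`. [folklore] -/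
private theorem bde_int_one_add_CX_pow {a : K} (ha : ‖a‖ ≤ 1) (m n : ℕ) :
    ‖coeff n ((1 + C a * X : K⟦X⟧) ^ m)‖ ≤ 1 := by
  induction m generalizing n with
  | zero =>
    rw [pow_zero, coeff_one]
    split_ifs <;> simp
  | succ m ih =>
    rw [pow_succ]
    refine bde_int_mul ih (fun k ↦ ?_) n
    rw [map_add, coeff_one, coeff_C_mul, coeff_X]
    rcases Nat.lt_trichotomy k 1 with hk | hk | hk
    · have : k = 0 := by omega
      subst this; simp
    · subst hk; simpa using ha
    · rw [if_neg (by omega), if_neg (by omega), mul_zero, add_zero, norm_zero]; exact zero_le_one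

variable [CharZero K]

omit [IsUltrametricDist K] in
/-- The divided derivative `F^{(k)}/k!` of an integral series is integral. [folklore] -/
private theorem bde_int_divided_derivative {F : K⟦X⟧} (hF : ∀ n, ‖coeff n F‖ ≤ 1)
    (hnat : ∀ m : ℕ, ‖(m : K)‖ ≤ 1) (k n : ℕ) :
    ‖coeff n (C ((k.factorial : K)⁻¹) * (derivative K)^[k] F)‖ ≤ 1 := by
  rw [coeff_C_mul, coeff_iterate_derivative, Nat.descFactorial_eq_factorial_mul_choose, Nat.cast_mul,
    ← mul_assoc, ← mul_assoc, inv_mul_cancel₀ (by exact_mod_cast Nat.factorial_ne_zero k), one_mul,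
    norm_mul]
  exact mul_le_one₀ (hnat _) (norm_nonneg _) (hF _)

/-- **Integrality induction for the rescaled identity.** Let `Φ, Φ' ∈ K⟦X⟧` be integral with a
coefficient of `Φ·Φ'` of norm `1`, `‖a‖ ≤ 1`, the natural numbers of norm `≤ 1` in `K`, and suppose
the identities `Φ·(1+aX)^k·Φ'^{(k)}/k! = Φ'·Σ_{i+j=k} (P_i aⁱ/i!)·(1+aX)^j·Φ^{(j)}/j!` hold for all `k`,
where `P_i = e(e−1)⋯(e−i+1)`. Then `‖P_k·aᵏ‖ ≤ ‖k!‖` for every `k`.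
[cite: Gouvea1993PadicNumbers, §5.9 Lemma 5.9.1 (converse) and Problem 194] -/
theorem norm_descPochhammer_mul_le_of_rescaled_identity {Φ Φ' : K⟦X⟧} {e a : K}
    (hΦ : ∀ n, ‖coeff n Φ‖ ≤ 1) (hΦ' : ∀ n, ‖coeff n Φ'‖ ≤ 1) {N : ℕ} (hN : ‖coeff N (Φ * Φ')‖ = 1)
    (ha : ‖a‖ ≤ 1) (hnat : ∀ m : ℕ, ‖(m : K)‖ ≤ 1)
    (hkey : ∀ k : ℕ, Φ * ((1 + C a * X) ^ k * (C ((k.factorial : K)⁻¹) * (derivative K)^[k] Φ')) =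
      Φ' * ∑ ij ∈ antidiagonal k,
        C ((∏ l ∈ range ij.1, (e - (l : K))) * a ^ ij.1 / (ij.1.factorial : K)) *
          ((1 + C a * X) ^ ij.2 * (C ((ij.2.factorial : K)⁻¹) * (derivative K)^[ij.2] Φ)))
    (k : ℕ) : ‖(∏ l ∈ range k, (e - (l : K))) * a ^ k‖ ≤ ‖(k.factorial : K)‖ := by
  induction k using Nat.strong_induction_on with
  | _ k ih =>
    have hkf : (k.factorial : K) ≠ 0 := by exact_mod_cast Nat.factorial_ne_zero k
    suffices h : ‖(∏ l ∈ range k, (e - (l : K))) * a ^ k / (k.factorial : K)‖ ≤ 1 by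
      rwa [norm_div, div_le_one (norm_pos_iff.2 hkf)] at h
    set c : ℕ → K := fun i ↦ (∏ l ∈ range i, (e - (l : K))) * a ^ i / (i.factorial : K) with hc
    have hci : ∀ i < k, ‖c i‖ ≤ 1 := fun i hi ↦ by
      have hif : (i.factorial : K) ≠ 0 := by exact_mod_cast Nat.factorial_ne_zero i
      rw [hc, norm_div, div_le_one (norm_pos_iff.2 hif)]
      exact ih i hi
    have hk := hkey k
    have hmem : (k, 0) ∈ antidiagonal k := by simp
    rw [← Finset.add_sum_erase _ _ hmem] at hk
    simp only [pow_zero, Nat.factorial_zero, Nat.cast_one, inv_one, map_one, one_mul,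
      Function.iterate_zero, id_eq] at hk
    have hsolve : C (c k) * (Φ * Φ') =
        Φ * ((1 + C a * X) ^ k * (C ((k.factorial : K)⁻¹) * (derivative K)^[k] Φ')) -
          Φ' * ∑ ij ∈ (antidiagonal k).erase (k, 0), C (c ij.1) *
            ((1 + C a * X) ^ ij.2 * (C ((ij.2.factorial : K)⁻¹) * (derivative K)^[ij.2] Φ)) := by
      rw [hk, hc]
      ring
    have hint : ∀ n, ‖coeff n (C (c k) * (Φ * Φ'))‖ ≤ 1 := by
      intro n
      rw [hsolve]
      refine bde_int_sub (bde_int_mul hΦ (bde_int_mul (bde_int_one_add_CX_pow ha k)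
        (bde_int_divided_derivative hΦ' hnat k))) (bde_int_mul hΦ' (bde_int_sum fun ij hij ↦ ?_)) n
      obtain ⟨hne, hij⟩ := mem_erase.1 hij
      have hi : ij.1 < k := by
        have hsum := mem_antidiagonal.1 hij
        rcases Nat.lt_or_ge ij.1 k with h | h
        · exact h
        · exfalso; apply hne
          exact Prod.ext (by omega) (by omega)
      exact bde_int_C_mul (hci ij.1 hi) (bde_int_mul (bde_int_one_add_CX_pow ha ij.2)
        (bde_int_divided_derivative hΦ hnat ij.2))
    have h := hint N
    rw [coeff_C_mul, norm_mul, hN, mul_one] at h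
    exact h

end Integral

/-! ## §4. No unit content: `‖e(e−1)⋯(e−k+1)‖·‖a‖ᵏ ≤ ‖k!‖` for every `0 < ‖a‖ < 1`, hence `e ∈ ℤ_p` -/

section NoUnitContent

variable {K : Type*} [NontriviallyNormedField K] [IsUltrametricDist K] [CharZero K]

omit [IsUltrametricDist K] [CharZero K] in
/-- The coefficients `aⁿ·[Xⁿ]F` of `F(aX)` tend to `0` for `F` integral and `‖a‖ < 1` (Gouvêa's passage
to a closed subdisc `x = ϖy`). [cite: Gouvea1993PadicNumbers, §5.6 Cor. 5.6.3 (proof)] -/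
theorem tendsto_coeff_rescale_of_norm_lt_one {F : K⟦X⟧} (hF : ∀ n, ‖coeff n F‖ ≤ 1) {a : K}
    (ha : ‖a‖ < 1) : Tendsto (fun n ↦ coeff n (rescale a F)) atTop (𝓝 0) := by
  have h0 : Tendsto (fun n ↦ ‖a‖ ^ n) atTop (𝓝 0) := tendsto_pow_atTop_nhds_zero_of_lt_one (norm_nonneg _) ha
  refine squeeze_zero_norm (fun n ↦ ?_) h0
  rw [coeff_rescale, norm_mul, norm_pow]
  exact mul_le_of_le_one_right (pow_nonneg (norm_nonneg _) _) (hF n)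

omit [IsUltrametricDist K] [CharZero K] in
/-- **Normalisation on a closed subdisc.** For `F ≠ 0` integral and `0 < ‖a‖ < 1` there is a scalar
`λ ≠ 0` with `‖λ‖ ≥ 1` such that `λ·F(aX)` is integral with a coefficient of norm `1` (divide by a
coefficient of maximal norm, Strassman's index). [cite: Gouvea1993PadicNumbers, §5.6 Thm. 5.6.1 (remark after the statement)] -/
theorem exists_normalisation_rescale {F : K⟦X⟧} (hF : ∀ n, ‖coeff n F‖ ≤ 1) (hF0 : F ≠ 0) {a : K}
    (ha0 : a ≠ 0) (ha : ‖a‖ < 1) :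
    ∃ lam : K, lam ≠ 0 ∧ 1 ≤ ‖lam‖ ∧ (∀ n, ‖coeff n (C lam * rescale a F)‖ ≤ 1) ∧
      ∃ N, ‖coeff N (C lam * rescale a F)‖ = 1 := by
  have hne : (fun n ↦ coeff n (rescale a F)) ≠ 0 := by
    intro h
    apply hF0
    ext n
    have hn := congrFun h n
    simp only [Pi.zero_apply, coeff_rescale, mul_eq_zero, pow_eq_zero_iff', ne_eq] at hn
    rcases hn with hn | hn
    · exact absurd hn.1 ha0
    · rw [hn, map_zero]
  obtain ⟨N, hN0, hNmax, -⟩ := exists_strassmann_index (tendsto_coeff_rescale_of_norm_lt_one hF ha) hne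
  set b : K := coeff N (rescale a F) with hb
  have hb0 : b ≠ 0 := hN0
  have hb1 : ‖b‖ ≤ 1 := by
    rw [hb, coeff_rescale, norm_mul, norm_pow]
    exact mul_le_one₀ (pow_le_one₀ (norm_nonneg _) ha.le) (norm_nonneg _) (hF N)
  refine ⟨b⁻¹, inv_ne_zero hb0, ?_, fun n ↦ ?_, N, ?_⟩
  · rw [norm_inv]; exact one_le_inv_iff₀.2 ⟨norm_pos_iff.2 hb0, hb1⟩
  · rw [coeff_C_mul, norm_mul, norm_inv]
    exact (inv_mul_le_iff₀ (norm_pos_iff.2 hb0)).2 (by rw [mul_one]; exact hNmax n)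
  · rw [coeff_C_mul, ← hb, inv_mul_cancel₀ hb0, norm_one]

/-- **No unit content needed on a subdisc.** If `F' = Q·F` in `K⟦X⟧` with `(1+X)Q′ = eQ`, `F, F'`
integral and non-zero, and the natural numbers have norm `≤ 1`, then for every `a` with
`0 < ‖a‖ < 1` and every `k`: `‖e(e−1)⋯(e−k+1)‖·‖a‖ᵏ ≤ ‖k!‖` — all coefficients of `(1 + aX)^e` are
integral. [cite: Gouvea1993PadicNumbers, §5.9 Lemma 5.9.1 (converse) and Problem 194] -/
theorem norm_descPochhammer_mul_norm_pow_le_of_binomial_twist {F F' Q : K⟦X⟧} {e : K}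
    (hQ : (1 + X) * derivative K Q = C e * Q) (hF' : F' = Q * F)
    (hFi : ∀ n, ‖coeff n F‖ ≤ 1) (hF'i : ∀ n, ‖coeff n F'‖ ≤ 1) (hF0 : F ≠ 0) (hF'0 : F' ≠ 0)
    (hnat : ∀ m : ℕ, ‖(m : K)‖ ≤ 1) {a : K} (ha0 : a ≠ 0) (ha : ‖a‖ < 1) (k : ℕ) :
    ‖∏ l ∈ range k, (e - (l : K))‖ * ‖a‖ ^ k ≤ ‖(k.factorial : K)‖ := by
  classical
  obtain ⟨lam, hlam0, -, hΦ, hΦu⟩ := exists_normalisation_rescale hFi hF0 ha0 ha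
  obtain ⟨lam', hlam'0, -, hΦ', hΦ'u⟩ := exists_normalisation_rescale hF'i hF'0 ha0 ha
  set Φ : K⟦X⟧ := C lam * rescale a F with hΦdef
  set Φ' : K⟦X⟧ := C lam' * rescale a F' with hΦ'def
  -- first unit coefficients and Gauss's lemma
  let N := Nat.find hΦu
  let N' := Nat.find hΦ'u
  have hN : ‖coeff N Φ‖ = 1 := Nat.find_spec hΦu
  have hN' : ‖coeff N' Φ'‖ = 1 := Nat.find_spec hΦ'u
  have hNlt : ∀ n < N, ‖coeff n Φ‖ < 1 := fun n hn ↦ lt_of_le_of_ne (hΦ n) (Nat.find_min hΦu hn)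
  have hN'lt : ∀ n < N', ‖coeff n Φ'‖ < 1 := fun n hn ↦ lt_of_le_of_ne (hΦ' n) (Nat.find_min hΦ'u hn)
  have hunit := norm_coeff_mul_eq_one_of_first_unit hΦ hΦ' hN hNlt hN' hN'lt
  -- the rescaled identity for `(Φ, Φ')` (it is bilinear in `(F, F')`)
  have hkey : ∀ k : ℕ, Φ * ((1 + C a * X) ^ k * (C ((k.factorial : K)⁻¹) * (derivative K)^[k] Φ')) =
      Φ' * ∑ ij ∈ antidiagonal k,
        C ((∏ l ∈ range ij.1, (e - (l : K))) * a ^ ij.1 / (ij.1.factorial : K)) *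
          ((1 + C a * X) ^ ij.2 * (C ((ij.2.factorial : K)⁻¹) * (derivative K)^[ij.2] Φ)) := by
    intro k
    have h := rescale_mul_divided_derivative_eq_sum_of_binomial_twist hQ hF' ha0 k
    have h2 := congrArg (fun S : K⟦X⟧ ↦ C lam * C lam' * S) h
    simp only [hΦdef, hΦ'def, iterate_derivative_C_mul] at h2 ⊢
    convert h2 using 1
    · ring
    · rw [mul_sum, mul_sum, mul_sum]
      refine sum_congr rfl fun ij _ ↦ ?_
      ring
  have h := norm_descPochhammer_mul_le_of_rescaled_identity hΦ hΦ' hunit ha.le hnat hkey k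
  rwa [norm_mul, norm_pow] at h

end NoUnitContent

section Padic

variable {p : ℕ} [hp : Fact p.Prime] {K : Type*} [NontriviallyNormedField K] [instK : NormedAlgebra ℚ_[p] K]

include instK in
/-- `‖m‖ ≤ 1` for natural numbers in a normed `ℚ_p`-algebra. [folklore] -/
private theorem bde_norm_natCast_le_one (m : ℕ) : ‖(m : K)‖ ≤ 1 := by
  rw [← map_natCast (algebraMap ℚ_[p] K) m, norm_algebraMap']
  exact_mod_cast Padic.norm_int_le_one (p := p) m

/-- **The exponent of a binomial twist between non-zero integral series is a `p`-adic integer**, with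
NO unit-content hypothesis, over a normed `ℚ_p`-algebra `K` whose norms accumulate at `1` from below
(e.g. `ℂ_p`): if `F' = Q·F` with `(1+X)Q′ = eQ` and `F, F' ≠ 0` have coefficients of norm `≤ 1`, then
`e ∈ ℤ_p`. [cite: Gouvea1993PadicNumbers, §5.9 Lemma 5.9.1 (converse) and Problem 194] -/
theorem exists_padicInt_eq_of_binomial_twist_of_ne_zero
    (hdense : ∀ r : ℝ, r < 1 → ∃ a : K, r < ‖a‖ ∧ ‖a‖ < 1)
    {F F' Q : K⟦X⟧} {e : K}
    (hQ : (1 + X) * derivative K Q = C e * Q) (hF' : F' = Q * F)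
    (hFi : ∀ n, ‖coeff n F‖ ≤ 1) (hF'i : ∀ n, ‖coeff n F'‖ ≤ 1) (hF0 : F ≠ 0) (hF'0 : F' ≠ 0) :
    ∃ z : ℤ_[p], algebraMap ℚ_[p] K (z : ℚ_[p]) = e := by
  have : IsUltrametricDist K := IsUltrametricDist.of_normedAlgebra ℚ_[p]
  have : CharZero K := charZero_of_injective_algebraMap (algebraMap ℚ_[p] K).injective
  refine exists_padicInt_eq_of_norm_descPochhammer_le (p := p) fun k ↦ ?_
  -- `‖P_k‖·‖a‖^k ≤ ‖k!‖` for all `0 < ‖a‖ < 1`; let `‖a‖ → 1`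
  have hkf : 0 < ‖(k.factorial : K)‖ := norm_pos_iff.2 (by exact_mod_cast Nat.factorial_ne_zero k)
  by_contra hlt
  push Not at hlt
  have hP : 0 < ‖∏ l ∈ range k, (e - (l : K))‖ := hkf.trans hlt
  rcases Nat.eq_zero_or_pos k with hk | hk
  · subst hk; simp at hlt
  -- choose `a` with `(‖k!‖/‖P_k‖)^{1/k} < ‖a‖ < 1`
  set r : ℝ := (‖(k.factorial : K)‖ / ‖∏ l ∈ range k, (e - (l : K))‖) ^ ((k : ℝ)⁻¹) with hr
  have hq : ‖(k.factorial : K)‖ / ‖∏ l ∈ range k, (e - (l : K))‖ < 1 := (div_lt_one hP).2 hlt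
  have hq0 : 0 < ‖(k.factorial : K)‖ / ‖∏ l ∈ range k, (e - (l : K))‖ := div_pos hkf hP
  have hr1 : r < 1 := Real.rpow_lt_one hq0.le hq (inv_pos.2 (by exact_mod_cast hk))
  obtain ⟨a, hra, ha1⟩ := hdense r hr1
  have ha0 : a ≠ 0 := fun h ↦ by
    rw [h, norm_zero] at hra
    exact not_le.2 hra (Real.rpow_nonneg hq0.le _)
  have hmain := norm_descPochhammer_mul_norm_pow_le_of_binomial_twist hQ hF' hFi hF'i hF0 hF'0
    (bde_norm_natCast_le_one (p := p)) ha0 ha1 k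
  -- `r^k = ‖k!‖/‖P_k‖ < ‖a‖^k`
  have hrk : r ^ k = ‖(k.factorial : K)‖ / ‖∏ l ∈ range k, (e - (l : K))‖ := by
    rw [hr, ← Real.rpow_natCast, ← Real.rpow_mul hq0.le, inv_mul_cancel₀ (by exact_mod_cast hk.ne'),
      Real.rpow_one]
  have hak : ‖(k.factorial : K)‖ / ‖∏ l ∈ range k, (e - (l : K))‖ < ‖a‖ ^ k := by
    rw [← hrk]
    exact pow_lt_pow_left₀ hra (Real.rpow_nonneg hq0.le _) hk.ne'
  have : ‖(k.factorial : K)‖ < ‖∏ l ∈ range k, (e - (l : K))‖ * ‖a‖ ^ k := by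
    rw [div_lt_iff₀ hP] at hak
    linarith [hak]
  exact absurd hmain (not_le.2 this)

variable [CompleteSpace K]
include hp instK

/-- **Node-proportional values ⟹ binomial twist with exponent in `ℤ_p`, WITHOUT unit content.**
Let `K` be a complete normed `ℚ_p`-algebra whose norms accumulate at `1` from below, `f, g ∈ K⟦X⟧`
integral, `u` a one-unit which is not a root of unity, `c, d ≠ 0`, with
`g(uᵗ − 1) = c·dᵗ·f(uᵗ − 1)` for all `t ∈ ℕ` and one `f(u^{t₀} − 1) ≠ 0`. Then `g = Q·f` with
`(1 + X)Q′ = zQ`, `z ∈ ℤ_p` (so `Q = Q(0)·(1+X)^z`), and `‖[Xⁿ]Q‖ ≤ ‖Q(0)‖` for all `n`.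
[cite: Robert2000PadicAnalysis, Ch. V §2.4 Theorem 1; Ch. VI §2.1 Theorem (Strassman)]
[cite: Gouvea1993PadicNumbers, §5.9 Lemma 5.9.1 (converse) and Problem 194] -/
theorem exists_padicInt_binomial_twist_of_node_values_of_ne_zero
    (hdense : ∀ r : ℝ, r < 1 → ∃ a : K, r < ‖a‖ ∧ ‖a‖ < 1)
    {f g : K⟦X⟧} (hf : ∀ n, ‖coeff n f‖ ≤ 1) (hg : ∀ n, ‖coeff n g‖ ≤ 1)
    {u c d : K} (hu : ‖u - 1‖ < 1) (hroot : ∀ n : ℕ, 0 < n → u ^ n ≠ 1) (hc : c ≠ 0) (hd : d ≠ 0)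
    (hrel : ∀ t : ℕ, ∑' n, coeff n g * (u ^ t - 1) ^ n = c * d ^ t * ∑' n, coeff n f * (u ^ t - 1) ^ n)
    {t₀ : ℕ} (h0 : ∑' n, coeff n f * (u ^ t₀ - 1) ^ n ≠ 0) :
    ∃ (z : ℤ_[p]) (Q : K⟦X⟧), g = Q * f ∧
      (1 + X) * derivative K Q = C (algebraMap ℚ_[p] K (z : ℚ_[p])) * Q ∧
      ∀ n, ‖coeff n Q‖ ≤ ‖constantCoeff Q‖ := by
  have : IsUltrametricDist K := IsUltrametricDist.of_normedAlgebra ℚ_[p]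
  have : CharZero K := charZero_of_injective_algebraMap (algebraMap ℚ_[p] K).injective
  obtain ⟨e, he⟩ := exists_wronskian_eq_of_node_values (p := p) hf hg hu hroot hc hd hrel h0
  have hf0 : f ≠ 0 := by
    intro h; apply h0; simp [h]
  have hg0 : g ≠ 0 := by
    intro h
    have h1 := hrel t₀
    rw [h] at h1
    simp only [map_zero, zero_mul, tsum_zero] at h1
    exact mul_ne_zero (mul_ne_zero hc (pow_ne_zero _ hd)) h0 h1.symm
  obtain ⟨Q, hgQ, hQ⟩ := exists_ode_of_wronskian hf0 he
  obtain ⟨z, hz⟩ := exists_padicInt_eq_of_binomial_twist_of_ne_zero (p := p) hdense hQ hgQ hf hg hf0 hg0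
  refine ⟨z, Q, hgQ, by rw [hz]; exact hQ, ?_⟩
  rw [← hz] at hQ
  exact norm_coeff_le_norm_constantCoeff_of_ode_padicInt (p := p) hQ

end Padic

/-! ## §5. The field `ℂ_p`: norms accumulate at `1` -/

section PadicComplex

variable {p : ℕ} [hp : Fact p.Prime]

/-- **In `ℂ_p` the norms accumulate at `1` from below**: for every `r < 1` there is `a ∈ ℂ_p` with
`r < ‖a‖ < 1` (take an `n`-th root of `p`, `‖a‖ = p^{−1/n}`; `ℂ_p` is algebraically closed).
[cite: Robert2000PadicAnalysis, Ch. III §3.4 (the value group of `ℂ_p` is `p^ℚ`)] -/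
theorem PadicComplex.exists_norm_lt_one_lt (r : ℝ) (hr : r < 1) :
    ∃ a : ℂ_[p], r < ‖a‖ ∧ ‖a‖ < 1 := by
  have hp1 : 1 < (p : ℝ) := by exact_mod_cast hp.out.one_lt
  have hpinv : (p : ℝ)⁻¹ < 1 := inv_lt_one_of_one_lt₀ hp1
  have hpinv0 : 0 < (p : ℝ)⁻¹ := by positivity
  have hpn : ‖(p : ℂ_[p])‖ = (p : ℝ)⁻¹ := by
    rw [← map_natCast (algebraMap ℚ_[p] ℂ_[p]) p, norm_algebraMap', Padic.norm_p]
  -- `n` with `max(r,0)^{n+1} < p⁻¹`, and an `(n+1)`-st root `a` of `p`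
  set r' : ℝ := max r 0 with hr'
  have hr'0 : 0 ≤ r' := le_max_right _ _
  have hr'1 : r' < 1 := max_lt hr one_pos
  obtain ⟨n, hn⟩ := exists_pow_lt_of_lt_one hpinv0 hr'1
  have hn' : r' ^ (n + 1) < (p : ℝ)⁻¹ :=
    (pow_le_pow_of_le_one hr'0 hr'1.le (Nat.le_succ n)).trans_lt hn
  obtain ⟨a, ha⟩ := IsAlgClosed.exists_pow_nat_eq (p : ℂ_[p]) (Nat.succ_pos n)
  have hna : ‖a‖ ^ (n + 1) = (p : ℝ)⁻¹ := by rw [← norm_pow, ha, hpn]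
  refine ⟨a, ?_, ?_⟩
  · refine (le_max_left r 0).trans_lt ?_
    exact lt_of_pow_lt_pow_left₀ (n + 1) (norm_nonneg _) (by rw [hna]; exact hn')
  · exact (pow_lt_one_iff_of_nonneg (norm_nonneg _) (Nat.succ_ne_zero n)).1 (by rw [hna]; exact hpinv)

/-- **The `ℂ_p` node theorem (no unit content).** `f, g ∈ ℂ_p⟦X⟧` integral, `u` a one-unit not a root
of unity, `c, d ≠ 0`, `g(uᵗ − 1) = c·dᵗ·f(uᵗ − 1)` for all `t ∈ ℕ`, one `f(u^{t₀} − 1) ≠ 0` ⟹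
`g = Q·f` with `(1+X)Q′ = zQ`, `z ∈ ℤ_p`, `‖[Xⁿ]Q‖ ≤ ‖Q(0)‖`.
[cite: Robert2000PadicAnalysis, Ch. V §2.4 Theorem 1; Ch. VI §2.1 Theorem (Strassman)]
[cite: Gouvea1993PadicNumbers, §5.9 Lemma 5.9.1 (converse) and Problem 194] -/
theorem PadicComplex.exists_padicInt_binomial_twist_of_node_values
    {f g : ℂ_[p]⟦X⟧} (hf : ∀ n, ‖coeff n f‖ ≤ 1) (hg : ∀ n, ‖coeff n g‖ ≤ 1)
    {u c d : ℂ_[p]} (hu : ‖u - 1‖ < 1) (hroot : ∀ n : ℕ, 0 < n → u ^ n ≠ 1) (hc : c ≠ 0) (hd : d ≠ 0)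
    (hrel : ∀ t : ℕ, ∑' n, coeff n g * (u ^ t - 1) ^ n = c * d ^ t * ∑' n, coeff n f * (u ^ t - 1) ^ n)
    {t₀ : ℕ} (h0 : ∑' n, coeff n f * (u ^ t₀ - 1) ^ n ≠ 0) :
    ∃ (z : ℤ_[p]) (Q : ℂ_[p]⟦X⟧), g = Q * f ∧
      (1 + X) * derivative ℂ_[p] Q = C (((z : ℚ_[p]) : ℂ_[p])) * Q ∧
      ∀ n, ‖coeff n Q‖ ≤ ‖constantCoeff Q‖ :=
  exists_padicInt_binomial_twist_of_node_values_of_ne_zero (p := p) PadicComplex.exists_norm_lt_one_lt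
    hf hg hu hroot hc hd hrel h0

end PadicComplex

end Literature.NumberTheory.LocalFields
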